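import Summits.HodgeConjecture.HodgeConjecture.Theorems.Ring2HypothesesDescentAbsoluteJacobians
import Literature.AlgebraicGeometry.Motives.AbelianVarietyQuotientOfJacobianHolds
import HarnessLib

/-!
# Ring 2 — the Jacobian forms of `HC_AV` and of row b06, with the quotient-of-a-Jacobian theorem DISCHARGED

research route conditional on HC_CM; not a corollary; Q11.4-sentence-2 already refuted in dim ≥ 3.

Companion of `Theorems/Ring2HypothesesDescentAbsoluteJacobians` (ring2-b06 g74, p265809/p266348). That file states
`HC_AV ⟺ HC for the Jacobian of every smooth projective complex curve` and the Jacobian forms of row b06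
(`AbsoluteHodgeImpliesAlgebraicAV`), each GRANTED the named Literature fact
`Motives.langeBirkenhake1992_exists_jacobian_surjective_hom` (Lange–Birkenhake, *Complex Abelian Varieties*,
Prop. 4.5.8 = Milne, *Jacobian Varieties*, §10 Thm. 10.1: every complex abelian variety is a quotient of a Jacobian),
displayed as the hypothesis `hJ`. That fact is now a THEOREM of the tree —
`Motives.langeBirkenhake1992_exists_jacobian_surjective_hom_holds`
(`Literature/AlgebraicGeometry/Motives/AbelianVarietyQuotientOfJacobianHolds.lean`, p268802: a Lefschetz curve section
`C → A` injective on `H¹`, the Jacobian of `C`, Milne's Prop. 6.1 homomorphism `J(C) → A`, onto because injective on `H¹`)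
— so `hJ` is discharged BY NAME here:

* `hc_av_iff_jacobians` — **`HC_AV ⟺ the Hodge conjecture holds for the Jacobian of every smooth projective complex
  curve**, HYPOTHESIS-FREE; `not_hc_av_iff_exists_jacobian` — a counterexample to `HC_AV`, if any, lives on a Jacobian;
  `hodgeConjectureFor_abelian_of_forall_jacobian` — per variety.
* `absoluteHodgeImpliesAlgebraicAV_iff_jacobians_of_canonical` / `…_of_grothendieck` — row b06 ⟺ Charles–Schnell 11.2.18
  for all Jacobians of curves, modulo the booked facts (N) `chartConjugation_canonical` (+ (E), resp. + (G)
  `grothendieck_comparison_realize_surjective`) ONLY; `absoluteHodgeImpliesAlgebraicAV_iff_jacobians_of_deligne` /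
  `absoluteHodgeImpliesAlgebraicAV_iff_hodge_jacobians_of_deligne` — the same modulo c1
  `deligne1982_hodgeClasses_abelianVariety_absoluteHodge` ONLY.

Nothing is decided: every theorem is an equivalence between OPEN statements or a transfer lemma; `HC_CM` does not occur;
`HC_AV` and row b06 occur only inside `↔` or as hypotheses; (N), (E), (G), c1 remain hypotheses where displayed. No
definition, no named fact, no `sorry`; axioms `propext`, `Classical.choice`, `Quot.sound`.

## References

* [LangeBirkenhake1992] H. Lange, Ch. Birkenhake, Complex Abelian Varieties (1992), Prop. 4.5.8, Lemma 4.5.7.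
* [Milne1986JacobianVarieties] J. S. Milne, Jacobian Varieties (1986), §6 Prop. 6.1, §10 Thm. 10.1.
* [MumfordAV1970] D. Mumford, Abelian Varieties (1970), §19 Thm. 1.
* [CharlesSchnell2014Notes] F. Charles, Ch. Schnell, Notes on absolute Hodge classes (2014), §11.2.2, Conj. 11.2.18.
* [Deligne1982HodgeCycles] P. Deligne, Hodge cycles on abelian varieties (1982), Main Thm. 2.11.
-/

noncomputable section

set_option linter.dupNamespace false

open CategoryTheory AlgebraicGeometry
open Literature.AlgebraicGeometry Literature.AlgebraicGeometry.Motives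
open Literature.AlgebraicGeometry.HodgeTheory

namespace Summit.HodgeConjecture.HodgeConjecture.Ring2.Hypotheses

open Summit.HodgeConjecture.HodgeConjecture.Theses.PadicSemiregularLift (HodgeAbelianVarieties)

/-! ## §1 `HC_AV` is a statement about Jacobians of curves — hypothesis-free -/

/-- **`HC_AV ⟺ THE HODGE CONJECTURE HOLDS FOR THE JACOBIAN OF EVERY SMOOTH PROJECTIVE COMPLEX CURVE** — hypothesis-free.
`⟹` is the restriction; `⟸`: every complex abelian variety is a quotient `J(C) ↠ A` of a Jacobian (Lange–Birkenhake
Prop. 4.5.8 / Milne JV Thm. 10.1, the tree's THEOREM `langeBirkenhake1992_exists_jacobian_surjective_hom_holds`) and the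
Hodge conjecture descends to quotient abelian varieties (`HodgeConjectureFor.of_surjective_hom`). Neither side is
asserted. [cite: LangeBirkenhake1992, Prop. 4.5.8] [cite: Milne1986JacobianVarieties, §10 Thm. 10.1 (p. 198)]
[cite: MumfordAV1970, §19 Thm. 1 and Remark p. 169] -/
theorem hc_av_iff_jacobians :
    HodgeAbelianVarieties ↔
      ∀ (C : SchemeOver ℂ), IsSmoothProjective 1 C → ∀ 𝒥 : Jacobian C, HodgeConjectureFor 𝒥.J.dim 𝒥.J.X :=
  hc_av_iff_jacobians_of_langeBirkenhake langeBirkenhake1992_exists_jacobian_surjective_hom_holds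

/-- **A counterexample to `HC_AV`, if any, can be taken on the Jacobian of a curve** (hypothesis-free `¬`-form; nothing
is asserted about `HC_AV`). [cite: LangeBirkenhake1992, Prop. 4.5.8] [cite: Milne1986JacobianVarieties, §10 Thm. 10.1 (p. 198)] -/
theorem not_hc_av_iff_exists_jacobian :
    ¬ HodgeAbelianVarieties ↔
      ∃ C : SchemeOver ℂ, IsSmoothProjective 1 C ∧ ∃ 𝒥 : Jacobian C, ¬ HodgeConjectureFor 𝒥.J.dim 𝒥.J.X :=
  not_hc_av_iff_exists_jacobian_of_langeBirkenhake langeBirkenhake1992_exists_jacobian_surjective_hom_holds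

/-- **Per variety, hypothesis-free in the quotient theorem**: if the Hodge conjecture holds for the Jacobian of every
smooth projective complex curve, it holds for every complex abelian variety `A` (`A` is a quotient of some `J(C)`,
`langeBirkenhake1992_exists_jacobian_surjective_hom_holds`, and HC descends along `J(C) ↠ A`). The hypothesis is NOT
asserted. [cite: LangeBirkenhake1992, Prop. 4.5.8] [cite: MumfordAV1970, §19 Thm. 1 and Remark p. 169] -/
theorem hodgeConjectureFor_abelian_of_forall_jacobian
    (h : ∀ (C : SchemeOver ℂ), IsSmoothProjective 1 C → ∀ 𝒥 : Jacobian C, HodgeConjectureFor 𝒥.J.dim 𝒥.J.X)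
    (A : AbelianVariety ℂ) : HodgeConjectureFor A.dim A.X :=
  hc_av_iff_jacobians.2 h A

/-! ## §2 Row b06 is a statement about Jacobians of curves — modulo (N)+(E) / (N)+(G) / c1 only -/

/-- **ROW b06 ⟺ 11.2.18 FOR THE JACOBIAN OF EVERY SMOOTH PROJECTIVE COMPLEX CURVE, modulo (N)+(E) only** (the chart
form; the quotient theorem is discharged by name). None of (N), (E), row b06 is asserted.
[cite: CharlesSchnell2014Notes, §11.2.2 (11.2.2) and §11.2.5 Conj. 11.2.18] [cite: LangeBirkenhake1992, Prop. 4.5.8] -/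
theorem absoluteHodgeImpliesAlgebraicAV_iff_jacobians_of_canonical
    (hN : chartConjugation_canonical)
    (hex : ∀ ⦃n : ℕ⦄ ⦃X : SchemeOver ℂ⦄, IsSmoothProjective n X →
      ∀ (σ : ℂ ≃+* ℂ) (p : ℕ) (c : complexBetti X (2 * p)), ∃ s, IsConjugateClass σ X (2 * p) c s) :
    AbsoluteHodgeImpliesAlgebraicAV ↔
      ∀ (C : SchemeOver ℂ), IsSmoothProjective 1 C →
        ∀ 𝒥 : Jacobian C, AbsoluteHodgeClassesAreAlgebraicFor 𝒥.J.dim 𝒥.J.X :=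
  absoluteHodgeImpliesAlgebraicAV_iff_jacobians_of_canonical_of_langeBirkenhake hN hex
    langeBirkenhake1992_exists_jacobian_surjective_hom_holds

/-- **Row b06 ⟺ its Jacobian form, modulo the named facts (N), (G) only.** None of (N), (G), row b06 is asserted.
[cite: CharlesSchnell2014Notes, §11.2.2 (11.2.1)–(11.2.3) and §11.2.5 Conj. 11.2.18] [cite: LangeBirkenhake1992, Prop. 4.5.8] -/
theorem absoluteHodgeImpliesAlgebraicAV_iff_jacobians_of_grothendieck
    (hN : chartConjugation_canonical) (hG : grothendieck_comparison_realize_surjective) :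
    AbsoluteHodgeImpliesAlgebraicAV ↔
      ∀ (C : SchemeOver ℂ), IsSmoothProjective 1 C →
        ∀ 𝒥 : Jacobian C, AbsoluteHodgeClassesAreAlgebraicFor 𝒥.J.dim 𝒥.J.X :=
  absoluteHodgeImpliesAlgebraicAV_iff_jacobians_of_grothendieck_of_langeBirkenhake hN hG
    langeBirkenhake1992_exists_jacobian_surjective_hom_holds

/-- **ROW b06 ⟺ 11.2.18 FOR ALL JACOBIANS OF CURVES, MODULO c1 ALONE** (Deligne's Main Theorem 2.11 as the hypothesis
`hD`, NOT asserted; no (N), no (E); the quotient theorem discharged by name). Row b06 is NOT asserted.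
[cite: Deligne1982HodgeCycles, Main Thm. 2.11 (p. 19)] [cite: LangeBirkenhake1992, Prop. 4.5.8] -/
theorem absoluteHodgeImpliesAlgebraicAV_iff_jacobians_of_deligne
    (hD : deligne1982_hodgeClasses_abelianVariety_absoluteHodge) :
    AbsoluteHodgeImpliesAlgebraicAV ↔
      ∀ (C : SchemeOver ℂ), IsSmoothProjective 1 C →
        ∀ 𝒥 : Jacobian C, AbsoluteHodgeClassesAreAlgebraicFor 𝒥.J.dim 𝒥.J.X :=
  absoluteHodgeImpliesAlgebraicAV_iff_jacobians_of_deligne_of_langeBirkenhake hD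
    langeBirkenhake1992_exists_jacobian_surjective_hom_holds

/-- **Row b06 ⟺ the Hodge conjecture for all Jacobians of curves, modulo c1 alone** (the two roads meet on the Torelli
locus; `hD` NOT asserted, row b06 NOT asserted). [cite: Deligne1982HodgeCycles, Main Thm. 2.11 (p. 19)] [cite: LangeBirkenhake1992, Prop. 4.5.8] -/
theorem absoluteHodgeImpliesAlgebraicAV_iff_hodge_jacobians_of_deligne
    (hD : deligne1982_hodgeClasses_abelianVariety_absoluteHodge) :
    AbsoluteHodgeImpliesAlgebraicAV ↔
      ∀ (C : SchemeOver ℂ), IsSmoothProjective 1 C → ∀ 𝒥 : Jacobian C, HodgeConjectureFor 𝒥.J.dim 𝒥.J.X :=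
  absoluteHodgeImpliesAlgebraicAV_iff_hodge_jacobians_of_deligne_of_langeBirkenhake hD
    langeBirkenhake1992_exists_jacobian_surjective_hom_holds

/-! ## Audit: nothing is decided here

`HC_CM` does not occur; `HC_AV` / row b06 occur only inside `↔` (or as the hypothesis of the per-variety transfer);
(N), (E), (G), c1 occur only as hypotheses; the quotient-of-a-Jacobian theorem is consumed as the tree's theorem
`langeBirkenhake1992_exists_jacobian_surjective_hom_holds`. Axiom closures: the three standard axioms only. -/

#print axioms Summit.HodgeConjecture.HodgeConjecture.Ring2.Hypotheses.hc_av_iff_jacobians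
#print axioms Summit.HodgeConjecture.HodgeConjecture.Ring2.Hypotheses.absoluteHodgeImpliesAlgebraicAV_iff_jacobians_of_canonical
#print axioms Summit.HodgeConjecture.HodgeConjecture.Ring2.Hypotheses.absoluteHodgeImpliesAlgebraicAV_iff_jacobians_of_deligne

end Summit.HodgeConjecture.HodgeConjecture.Ring2.Hypotheses

end
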